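import Literature.Analysis.FluidPDE.ReleaseKernelFamily
import Literature.Analysis.FunctionSpaces.TorusConvolution
import HarnessLib

/-!
# The reversed kernel family: the marginal identity (incompressibility by duality)

Analysis/FluidPDE proof-support file (everything proved). For the reversed kernel family
`χ^w` of a smooth divergence-free drift `u` on `[0,T] × T^d` (`FluidPDE/ReleaseKernelFamily`:
`∂_τχ^w - u(T-τ)·∇χ^w = κΔχ^w`, `χ^w(0) = k_ε(· - w)`), the superposition
`m(τ, x) = ∫ χ^w(τ, x) dw` is identically `1`:

* `integral_mul_integral_reversedKernel_eq` — `∫ g(x) m(τ,x) dx = ∫ g` for every smooth `g` and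
  `τ ∈ (0, T]`: by the forward–backward duality (`ScalarTransportDuality`) with the forward
  solution `θ^g` from `g` on the window `[T-τ, T]`, `∫ g χ^w(τ) = ∫ θ^g(τ) k_ε(· - w)`, and
  integrating in `w` leaves the conserved mean `∫ θ^g(τ) = ∫ g`;
* `ae_integral_reversedKernel_eq_one` — hence `m(τ, ·) = 1` a.e. (density of smooth functions through
  mollification), for every `τ ∈ [0,T]`.

This is the Eulerian shadow of the incompressibility of the backward stochastic flow: the
two-point density `∫ χ^w(τ,x) χ^w(τ,y) dw` has Lebesgue marginals.

## References

* L. C. Evans, *Partial Differential Equations*, 2nd ed. (2010), §7.1.1 (adjoint problems),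
  App. C.4 Thm. 7 (mollification). [`Evans2010`]
-/

noncomputable section

open MeasureTheory Set Filter Topology Function Metric
open scoped InnerProductSpace ContDiff Convolution
open Literature.Analysis.FunctionSpaces Literature.Analysis.FunctionSpaces.Torus

namespace Literature.Analysis.FluidPDE

namespace Torus

variable {d : Type*} [Fintype d] [DecidableEq d]

section Marginal

variable {κ T ε : ℝ} {u : ℝ → UnitAddTorus d → EuclideanSpace ℝ d}
  {χ : UnitAddTorus d → ℝ → UnitAddTorus d → ℝ}

/-- **Duality for the reversed kernels**: for `τ ∈ (0,T]`, a smooth `g` and the forward solution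
`θ` of `∂ₜθ + u(t + T - τ)·∇θ = κΔθ`, `θ(0) = g` on `[0, τ]`:
`∫ θ(τ,x) k_ε(x - w) dx = ∫ g(x) χ^w(τ,x) dx`. [folklore] -/
theorem reversedKernel_duality
    (hχ : ∀ w, IsClassicalScalarTransportOn (Icc 0 T) κ (fun τ x => -u (T - τ) x) (χ w))
    (hχ0 : ∀ w x, χ w 0 x = kernel ε (x - w)) {τ : ℝ} (hτ0 : 0 < τ) (hτT : τ ≤ T)
    {g : UnitAddTorus d → ℝ} {θ : ℝ → UnitAddTorus d → ℝ}
    (hθ : IsClassicalScalarTransportOn (Icc 0 τ) κ (fun t x => u (t + (T - τ)) x) θ) (hθ0 : θ 0 = g)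
    (w : UnitAddTorus d) : ∫ x, θ τ x * kernel ε (x - w) = ∫ x, g x * χ w τ x := by
  have hχw : IsClassicalScalarTransportOn (Icc 0 τ) κ (fun σ x => -u (T - σ) x) (χ w) :=
    (hχ w).restrict_Icc hτ0 (Icc_subset_Icc_right hτT)
  have hrel : ∀ σ ∈ Icc 0 τ, ∀ x, (fun σ x => -u (T - σ) x) σ x = -(fun t x => u (t + (T - τ)) x) (τ - σ) x := by
    intro σ _ x
    simp only [neg_inj]
    congr 1; ring
  have h := IsClassicalScalarTransportOn.integral_mul_eq_of_reverse hτ0 hθ hχw hrel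
  simp_rw [hχ0, hθ0] at h
  exact h

/-- **The integrated marginal identity**: `∫ g(x) (∫ χ^w(τ,x) dw) dx = ∫ g` for smooth `g`,
`τ ∈ (0,T]`. [folklore] -/
theorem integral_mul_integral_reversedKernel_eq (hκ : 0 < κ) (hu : IsSmoothSpaceTimeOn (Icc 0 T) u)
    (hdiv : ∀ t ∈ Icc 0 T, IsDivFree (u t)) (hε : 0 < ε) (hε4 : ε ≤ 1 / 4)
    (hχ : ∀ w, IsClassicalScalarTransportOn (Icc 0 T) κ (fun τ x => -u (T - τ) x) (χ w))
    (hχ0 : ∀ w x, χ w 0 x = kernel ε (x - w)) {τ : ℝ} (hτ0 : 0 < τ) (hτT : τ ≤ T)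
    {g : UnitAddTorus d → ℝ} (hg : IsSmooth g) :
    ∫ x, g x * ∫ w, χ w τ x = ∫ x, g x := by
  have hτ : τ ∈ Icc 0 T := ⟨hτ0.le, hτT⟩
  -- the forward solution from `g` on the window `[T - τ, T]`
  have hv : IsSmoothSpaceTimeOn (Icc 0 τ) (fun t x => u (t + (T - τ)) x) :=
    IsSmoothSpaceTimeOn.shift hu (by linarith) (by linarith)
  have hvdiv : ∀ t ∈ Icc 0 τ, IsDivFree ((fun t x => u (t + (T - τ)) x) t) := fun t ht =>
    hdiv (t + (T - τ)) ⟨by linarith [ht.1], by linarith [ht.2]⟩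
  obtain ⟨θ, hθ, hθ0, -⟩ := exists_unique_isClassicalScalarTransportOn_of_forced
    exists_unique_isClassicalScalarTransportForcedOn_holds hκ hτ0 hv hvdiv hg
  -- duality for every `w`, integrated in `w`
  have hdual : ∀ w, ∫ x, θ τ x * kernel ε (x - w) = ∫ x, g x * χ w τ x := fun w =>
    reversedKernel_duality hχ hχ0 hτ0 hτT hθ hθ0 w
  have hθc : Continuous (θ τ) := (hθ.smooth_scalar.isSmooth_slice (right_mem_Icc.2 hτ0.le)).continuous
  have hkc : Continuous (kernel (d := d) ε) := continuous_kernel hε hε4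
  have hgc : Continuous g := hg.continuous
  have hχc := continuous_reversedKernel_slice hκ.le hε hε4 hχ hχ0 hτ
  -- left side: `∫∫ θ(τ,x) k(x-w) dx dw = ∫ θ(τ) = ∫ g`
  have hL : ∫ w, ∫ x, θ τ x * kernel ε (x - w) = ∫ x, g x := by
    have hcont : Continuous (uncurry fun (w x : UnitAddTorus d) => θ τ x * kernel ε (x - w)) :=
      (hθc.comp continuous_snd).mul (hkc.comp (continuous_snd.sub continuous_fst))
    rw [integral_integral_swap (integrable_prod_of_continuous' hcont)]
    have e : ∀ x, ∫ w, θ τ x * kernel ε (x - w) = θ τ x := fun x => by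
      rw [integral_const_mul, integral_kernel_sub_left hε hε4, mul_one]
    simp_rw [e]
    have hm := hθ.scalarMean_eq subset_rfl (right_mem_Icc.2 hτ0.le)
    simp only [scalarMean, hθ0] at hm
    exact hm
  -- right side: `∫∫ g(x) χ^w(τ,x) dx dw = ∫ g m`
  have hR : ∫ w, ∫ x, g x * χ w τ x = ∫ x, g x * ∫ w, χ w τ x := by
    have hcont : Continuous (uncurry fun (w x : UnitAddTorus d) => g x * χ w τ x) :=
      (hgc.comp continuous_snd).mul hχc
    rw [integral_integral_swap (integrable_prod_of_continuous' hcont)]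
    exact integral_congr_ae (Eventually.of_forall fun x => by simp only; rw [integral_const_mul])
  rw [← hR]
  simp_rw [← hdual]
  exact hL
where
  /-- A continuous function on `T^d × T^d` is integrable. [folklore] -/
  integrable_prod_of_continuous' {G : UnitAddTorus d × UnitAddTorus d → ℝ} (hG : Continuous G) :
      Integrable G ((volume : Measure (UnitAddTorus d)).prod volume) := by
    obtain ⟨C, hC⟩ := isCompact_univ.exists_bound_of_continuousOn hG.continuousOn
    exact Integrable.mono' (integrable_const C) hG.aestronglyMeasurable
      (Eventually.of_forall fun p => hC p (mem_univ p))

/-- **The marginal identity**: `∫ χ^w(τ, x) dw = 1` for a.e. `x`, for every `τ ∈ [0,T]`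
(`τ = 0`: unit mass of the reflected mollifier; `τ > 0`: the integrated identity against all
smooth `g` and the uniform approximation of the continuous function `m(τ,·) - 1` by its
mollifications). [folklore] -/
theorem ae_integral_reversedKernel_eq_one (hκ : 0 < κ) (hu : IsSmoothSpaceTimeOn (Icc 0 T) u)
    (hdiv : ∀ t ∈ Icc 0 T, IsDivFree (u t)) (hε : 0 < ε) (hε4 : ε ≤ 1 / 4)
    (hχ : ∀ w, IsClassicalScalarTransportOn (Icc 0 T) κ (fun τ x => -u (T - τ) x) (χ w))
    (hχ0 : ∀ w x, χ w 0 x = kernel ε (x - w)) {τ : ℝ} (hτ : τ ∈ Icc 0 T) :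
    ∀ᵐ x : UnitAddTorus d, ∫ w, χ w τ x = 1 := by
  rcases hτ.1.eq_or_lt with h0 | hτ0
  · subst h0
    refine Eventually.of_forall fun x => ?_
    simp_rw [hχ0]
    exact integral_kernel_sub_left hε hε4 x
  -- `ψ = m(τ,·) - 1` is continuous and orthogonal to every smooth function
  set ψ : UnitAddTorus d → ℝ := fun x => (∫ w, χ w τ x) - 1 with hψ
  have hmc : Continuous fun x : UnitAddTorus d => ∫ w, χ w τ x := continuous_integral_reversedKernel hκ.le hε hε4 hχ hχ0 hτ
  have hψc : Continuous ψ := hmc.sub continuous_const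
  have hψi : Integrable ψ volume := hψc.integrable_unitAddTorus
  have horth : ∀ g : UnitAddTorus d → ℝ, IsSmooth g → ∫ x, g x * ψ x = 0 := by
    intro g hg
    have h1 := integral_mul_integral_reversedKernel_eq hκ hu hdiv hε hε4 hχ hχ0 hτ0 hτ.2 hg
    have i1 : Integrable (fun x => g x * ∫ w, χ w τ x) volume := (hg.continuous.mul hmc).integrable_unitAddTorus
    have i2 : Integrable (fun x => g x * 1) volume := (hg.continuous.mul continuous_const).integrable_unitAddTorus
    have : ∫ x, g x * ψ x = (∫ x, g x * ∫ w, χ w τ x) - ∫ x, g x * 1 := by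
      rw [← integral_sub i1 i2]
      exact integral_congr_ae (Eventually.of_forall fun x => by simp only [hψ]; ring)
    rw [this, h1]
    simp
  -- `∫ ψ² ≤ η ∫ |ψ|` for every `η > 0`, by mollifying `ψ`
  have hbound : ∀ η : ℝ, 0 < η → ∫ x, ψ x ^ 2 ≤ η * ∫ x, |ψ x| := by
    intro η hη
    obtain ⟨ρ, hρ, happ⟩ := exists_forall_dist_convolution_le hψc hη
    set ε' : ℝ := min (ρ / 2) (1 / 4) with hε'
    have hε'0 : 0 < ε' := lt_min (half_pos hρ) (by norm_num)
    have hε'4 : ε' ≤ 1 / 4 := min_le_right _ _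
    have hsupp : support (kernel (d := d) ε') ⊆ ball 0 ρ :=
      (support_kernel_subset hε'0).trans (ball_subset_ball ((min_le_left _ _).trans (half_le_self hρ.le)))
    have hg : IsSmooth (kernel ε' ⋆ ψ) := by
      rw [convolution_comm_real]
      exact isSmooth_convolution hψi (isSmooth_kernel hε'0 hε'4)
    have happ' : ∀ x, |(kernel ε' ⋆ ψ) x - ψ x| ≤ η := fun x => by
      have := happ hsupp (fun y => kernel_nonneg hε'0.le y) (integral_kernel hε'0 hε'4) x
      rwa [Real.dist_eq] at this
    have h0 := horth _ hg
    have i1 : Integrable (fun x => ((kernel ε' ⋆ ψ) x - ψ x) * ψ x) volume :=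
      ((hg.continuous.sub hψc).mul hψc).integrable_unitAddTorus
    have i2 : Integrable (fun x => (kernel ε' ⋆ ψ) x * ψ x) volume := (hg.continuous.mul hψc).integrable_unitAddTorus
    have e : ∫ x, ψ x ^ 2 = -∫ x, ((kernel ε' ⋆ ψ) x - ψ x) * ψ x := by
      have i3 : Integrable (fun x => ψ x ^ 2) volume := (hψc.pow 2).integrable_unitAddTorus
      have h3 : ∫ x, ((kernel ε' ⋆ ψ) x - ψ x) * ψ x = (∫ x, (kernel ε' ⋆ ψ) x * ψ x) - ∫ x, ψ x ^ 2 := by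
        rw [← integral_sub i2 i3]
        exact integral_congr_ae (Eventually.of_forall fun x => by ring)
      rw [h3, h0]; ring
    rw [e, ← integral_const_mul]
    refine (neg_le_abs _).trans ((abs_integral_le_integral_abs).trans (integral_mono i1.abs
      ((hψc.abs.integrable_unitAddTorus).const_mul η) fun x => ?_))
    rw [abs_mul]
    exact mul_le_mul_of_nonneg_right (happ' x) (abs_nonneg _)
  -- hence `∫ ψ² = 0` and `ψ = 0` a.e.
  have hsq0 : ∫ x, ψ x ^ 2 = 0 := by
    refine le_antisymm ?_ (integral_nonneg fun x => sq_nonneg _)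
    refine le_of_forall_pos_le_add fun η hη => ?_
    have hI : 0 ≤ ∫ x, |ψ x| := integral_nonneg fun x => abs_nonneg _
    have := hbound (η / (1 + ∫ x, |ψ x|)) (by positivity)
    calc ∫ x, ψ x ^ 2 ≤ η / (1 + ∫ x, |ψ x|) * ∫ x, |ψ x| := this
      _ ≤ η := by
          rw [div_mul_eq_mul_div, div_le_iff₀ (by positivity)]; nlinarith
      _ ≤ 0 + η := by rw [zero_add]
  have hae : (fun x => ψ x ^ 2) =ᵐ[volume] 0 :=
    (integral_eq_zero_iff_of_nonneg (fun x => sq_nonneg _)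
      (show Integrable (fun x => ψ x ^ 2) volume from (hψc.pow 2).integrable_unitAddTorus)).1 hsq0
  filter_upwards [hae] with x hx
  have : ψ x = 0 := by simpa [sq_eq_zero_iff] using hx
  simp only [hψ, sub_eq_zero] at this
  exact this

end Marginal

end Torus

end Literature.Analysis.FluidPDE
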